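import Summits.QuantumFields.YangMills.Theorems.BalabanUVNodesN19SingleModeMomentFirstOrder
import Summits.QuantumFields.YangMills.Theorems.BalabanUVNodesN19SingleModeMomentCurrency

/-!
# YM-DAG node N19 (= NE7 proper) — THE FIRST-ORDER TAIL CORRECTION IN THE UNIFORM MIXED-MOMENT CURRENCY, PART B: the Jackson ladder with
# Taylor steps and MASS, the first-order correction, and the price for laws with `r`-close mixed moments (parametric form)

Cell `pub-ymgap`, HUMAN RULING D-0062 (Track A) ∕ D-0149 (work-bound push), R141 (C) wider-strategy seat `pub-ymgap-dag-n19-e` (strategy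
s3 = ALTERNATIVE CURRENCY), generation g32, module 6 (lineage module 144).  Route `Summits/QuantumFields/YangMills/Theses/BalabanUVNodes.lean`,
cluster item K3⁸ «SpineGivenEndpointR13SepCoPHV» (stmt-QuantumFields-27366); filed `--supports` that item `--as helper` (it proves no registered
stub).  COUNT-NEUTRAL: [folklore]∕[bookkeeping] over Mathlib and the lineage BY NAME — PART A `…N19SingleModeMomentFirstOrder`
(`exists_pair_near_cexp_sum_taylor_mass`, `exists_pair_firstOrder_step_mass`), module 128 `…N19SingleModeMomentLadder` (`exists_additiveJackson_mass`),
module 127 (`mass_sub_le`, `mass_C_le`), module 119 (`abs_l1Norm_sub_half_le`); no laws in this part, no scheme object, no Theses import; NOT a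
discharge claim.

CONTENT.  §1 `exists_ladder_pair_near_cexp_additiveJackson_mass` — module 139 §2's ladder (Jackson increments `B_l`, Taylor orders
`n_l = ⌈e²ωR_l⌉ + h`, base phase `ωd∕2`) with COEFFICIENT MASS in place of degree: a pair within `2(J+1)e^{−h}` of `e^{iωA_J(x)}` on the cube with
masses `≤ exp Λ`, **`Λ = (J+1)log 2 + (6πe²ωd + h(J+1))·log(1 + 10ωd) + (3πe²ωd(J+1) + h(2^{J+1} − 1))·log 81`**
(`mass B_l ≤ m_B(l)` as in module 129, `1 + ω·m_B(l) ≤ (1 + 10ωd)·81^{2^l}`, `n_l − 1 ≤ 3πe²ωd∕2^l + h`), `mass A_J ≤ d·2^J·9^{2^J}`,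
`|S − A_J| ≤ dπ∕2^J` · §2 ★★ `exists_pair_near_cexp_l1Norm_firstOrder_mass` — the first-order correction `× (1 + iω(A_N − A_J))` (`N ≥ 2^J`,
`ωdπ ≤ 2^J`): masses `≤ exp Λ·(1 + 2ωd·N·9^N)`, sup-error `≤ 2(J+1)e^{−h}(1 + ρ + τ) + ρ² + τ` (`ρ = ωdπ∕2^J`, `τ = ωdπ∕N`) — the moment-currency
twin of module 139's parametric form.  PART C (`…N19SingleModeMomentLogFree`) prices the pair for laws with `r`-close mixed moments
(`2·sup-error + exp Λ·(1 + 2ωdN9^N)·r`, module 127), chooses `2^J ≍ √(ωd·L)`, `h ≍ 3 log L`, `N ≍ L∕18` at `r = e^{−L}` and reads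
**`≲ C·ωd∕L + e^{−L∕2}`**: the row «UNIFORM MOMENTS r → single mode» loses its `log²L`.

HONEST FRAMING (binding).  Elementary and [folklore]; TOY laws under hypotheses; NO consumer in the DAG today (the seat's own currency map); nothing
of Bałaban's instantiated; NE7 NOT PRINTED, NOT proved; N19 NOT discharged; count-neutral.  One finite `T⁴` programme at fixed `ε`; nothing continuum ∕
`ℝ⁴` ∕ OS ∕ mass-gap ∕ Clay.  0 `def` ∕ 0 `sorry`.
-/

noncomputable section

open Finset Complex
open scoped Real

namespace Summit.QuantumFields.YangMills.Theorems.BalabanUVNodesN19SingleModeMomentFirstOrderLadder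

open Summit.QuantumFields.YangMills.Theorems.BalabanUVNodesN19SingleModeMomentFirstOrder
  (exists_pair_near_cexp_sum_taylor_mass exists_pair_firstOrder_step_mass)
open Summit.QuantumFields.YangMills.Theorems.BalabanUVNodesN19SingleModeMomentLadder (exists_additiveJackson_mass)
open Summit.QuantumFields.YangMills.Theorems.BalabanUVNodesN19CoefficientMassPricing
open Summit.QuantumFields.YangMills.Theorems.BalabanUVNodesN19SingleModeL1Norm (abs_l1Norm_sub_half_le)

variable {ι : Type*} [Fintype ι]

/-! ## §1 The Jackson ladder with Taylor steps and mass [folklore] -/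

/-- One level's mass factor: with `a = ωd ≥ 0`, `X ≥ 0`, `1 + X ≤ (1 + 10a)·81^{2^l}`, `k ≤ ν` (`k : ℕ`, `ν` real):
`2(1 + X)^k ≤ exp(log 2 + ν·(log(1 + 10a) + 2^l·log 81))`. [bookkeeping] -/
theorem level_mass_le {a X ν : ℝ} {k l : ℕ} (ha : 0 ≤ a) (hX : 0 ≤ X) (hX1 : 1 + X ≤ (1 + 10 * a) * 81 ^ (2 ^ l))
    (hk : (k : ℝ) ≤ ν) :
    2 * (1 + X) ^ k ≤ Real.exp (Real.log 2 + ν * (Real.log (1 + 10 * a) + 2 ^ l * Real.log 81)) := by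
  have h1X : 0 < 1 + X := by linarith
  have hlogY : Real.log ((1 + 10 * a) * 81 ^ (2 ^ l)) = Real.log (1 + 10 * a) + 2 ^ l * Real.log 81 := by
    rw [Real.log_mul (by positivity) (by positivity), Real.log_pow]; push_cast; ring
  have hlog0 : 0 ≤ Real.log (1 + 10 * a) + 2 ^ l * Real.log 81 :=
    add_nonneg (Real.log_nonneg (by linarith)) (mul_nonneg (by positivity) (Real.log_nonneg (by norm_num)))
  have hpow : (1 + X) ^ k = Real.exp (k * Real.log (1 + X)) := by
    rw [← Real.rpow_natCast, Real.rpow_def_of_pos h1X, mul_comm]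
  have hlogle : Real.log (1 + X) ≤ Real.log (1 + 10 * a) + 2 ^ l * Real.log 81 := by
    rw [← hlogY]; exact Real.log_le_log h1X hX1
  rw [Real.exp_add, Real.exp_log two_pos, hpow]
  refine mul_le_mul_of_nonneg_left (Real.exp_le_exp.2 ?_) zero_le_two
  calc (k : ℝ) * Real.log (1 + X) ≤ k * (Real.log (1 + 10 * a) + 2 ^ l * Real.log 81) :=
        mul_le_mul_of_nonneg_left hlogle (Nat.cast_nonneg k)
    _ ≤ ν * (Real.log (1 + 10 * a) + 2 ^ l * Real.log 81) := mul_le_mul_of_nonneg_right hk hlog0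

/-- **THE JACKSON LADDER WITH TAYLOR STEPS, TOP APPROXIMANT EXPOSED, WITH MASS.**  For `ω ≥ 0`, `J : ℕ`, `h ≥ 1` with `(J+1)e^{−h} ≤ ½` there are
real `MvPolynomial`s `Cr, Ci, A` with masses `mass Cr, mass Ci ≤ exp Λ`
(`Λ = (J+1)log 2 + (6πe²ωd + h(J+1))·log(1 + 10ωd) + (3πe²ωd(J+1) + h(2^{J+1} − 1))·log 81`, `d = |ι|`), `mass A ≤ d·2^J·9^{2^J}`,
`|Σ_i|x_i| − A(x)| ≤ dπ∕2^J` and `‖Cr(x) + Ci(x)·i − e^{iωA(x)}‖ ≤ 2(J+1)e^{−h}` on `[−1,1]^ι`.  The ladder of module 139 §2 (increments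
`B_0 = A_0 − d∕2`, `B_l = A_l − A_{l−1}`, `R_0 = d(½ + π)`, `R_l = 3dπ∕2^l`, orders `⌈e²ωR_l⌉ + h`) run through PART A's Taylor ladder with the mass
bounds `m_B(0) = 10d`, `m_B(l) = 2d·2^l·9^{2^l}` of module 129. [folklore] -/
theorem exists_ladder_pair_near_cexp_additiveJackson_mass {ω : ℝ} (hω : 0 ≤ ω) (J h : ℕ) (hh : 1 ≤ h)
    (hJh : ((J : ℝ) + 1) * Real.exp (-(h : ℝ)) ≤ 1 / 2) :
    ∃ Cr Ci A : MvPolynomial ι ℝ,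
      (∑ s ∈ Cr.support, |Cr.coeff s|) ≤ Real.exp (((J : ℝ) + 1) * Real.log 2 +
          (6 * π * Real.exp 2 * (ω * Fintype.card ι) + h * ((J : ℝ) + 1)) * Real.log (1 + 10 * (ω * Fintype.card ι)) +
          (3 * π * Real.exp 2 * (ω * Fintype.card ι) * ((J : ℝ) + 1) + h * (2 ^ (J + 1) - 1)) * Real.log 81) ∧
      (∑ s ∈ Ci.support, |Ci.coeff s|) ≤ Real.exp (((J : ℝ) + 1) * Real.log 2 +
          (6 * π * Real.exp 2 * (ω * Fintype.card ι) + h * ((J : ℝ) + 1)) * Real.log (1 + 10 * (ω * Fintype.card ι)) +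
          (3 * π * Real.exp 2 * (ω * Fintype.card ι) * ((J : ℝ) + 1) + h * (2 ^ (J + 1) - 1)) * Real.log 81) ∧
      (∑ s ∈ A.support, |A.coeff s|) ≤ Fintype.card ι * (2 ^ J * 9 ^ (2 ^ J)) ∧
      (∀ x : ι → ℝ, (∀ i, x i ∈ Set.Icc (-1 : ℝ) 1) → |(∑ i, |x i|) - MvPolynomial.eval x A| ≤ Fintype.card ι * π / 2 ^ J) ∧
      ∀ x : ι → ℝ, (∀ i, x i ∈ Set.Icc (-1 : ℝ) 1) →
        ‖((MvPolynomial.eval x Cr : ℝ) : ℂ) + ((MvPolynomial.eval x Ci : ℝ) : ℂ) * I -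
            exp (((ω * MvPolynomial.eval x A : ℝ) : ℂ) * I)‖ ≤ 2 * ((J : ℝ) + 1) * Real.exp (-(h : ℝ)) := by
  set d : ℝ := (Fintype.card ι : ℝ) with hd
  set a : ℝ := ω * d with ha
  have hd0 : 0 ≤ d := Nat.cast_nonneg _
  have ha0 : 0 ≤ a := mul_nonneg hω hd0
  have hπ3 : (3 : ℝ) < π := Real.pi_gt_three
  -- the Jackson ladder with masses
  choose A hAmass hAerr using fun l : ℕ => exists_additiveJackson_mass (ι := ι) (M := 2 ^ l) (pow_pos two_pos l)
  obtain ⟨A', hA'0, hA's⟩ : ∃ A' : ℕ → MvPolynomial ι ℝ, A' 0 = MvPolynomial.C (d / 2) ∧ ∀ l, A' (l + 1) = A l :=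
    ⟨fun l => if l = 0 then MvPolynomial.C (d / 2) else A (l - 1), if_pos rfl, fun l => by
      show (if l + 1 = 0 then MvPolynomial.C (d / 2) else A (l + 1 - 1)) = A l
      rw [if_neg (Nat.succ_ne_zero l), Nat.add_sub_cancel]⟩
  obtain ⟨B, hB⟩ : ∃ B : ℕ → MvPolynomial ι ℝ, ∀ l, B l = A l - A' l := ⟨fun l => A l - A' l, fun l => rfl⟩
  obtain ⟨R, hR0', hRs⟩ : ∃ R : ℕ → ℝ, R 0 = d * (1 / 2 + π) ∧ ∀ l, R (l + 1) = 3 * d * π / 2 ^ (l + 1) :=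
    ⟨fun l => if l = 0 then d * (1 / 2 + π) else 3 * d * π / 2 ^ l, if_pos rfl, fun l => if_neg (Nat.succ_ne_zero l)⟩
  obtain ⟨mB, hmB0, hmBs⟩ : ∃ mB : ℕ → ℝ, mB 0 = 10 * d ∧ ∀ l, mB (l + 1) = 2 * d * (2 ^ (l + 1) * 9 ^ (2 ^ (l + 1))) :=
    ⟨fun l => if l = 0 then 10 * d else 2 * d * (2 ^ l * 9 ^ (2 ^ l)), if_pos rfl, fun l => if_neg (Nat.succ_ne_zero l)⟩
  obtain ⟨n, hn⟩ : ∃ n : ℕ → ℕ, ∀ l, n l = ⌈Real.exp 2 * (ω * R l)⌉₊ + h := ⟨fun l => ⌈Real.exp 2 * (ω * R l)⌉₊ + h, fun l => rfl⟩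
  have hR0 : ∀ l, 0 ≤ R l := by
    intro l; cases l with
    | zero => rw [hR0']; positivity
    | succ l => rw [hRs]; positivity
  -- masses of the increments (module 129)
  have hmassB : ∀ l, l < J + 1 → (∑ s ∈ (B l).support, |(B l).coeff s|) ≤ mB l := by
    intro l _
    rw [hB]
    refine (mass_sub_le _ _).trans ?_
    cases l with
    | zero =>
      rw [hA'0, hmB0]
      have h1 : (∑ s ∈ (A 0).support, |(A 0).coeff s|) ≤ d * 9 := by
        have := hAmass 0; rw [← hd] at this; simpa using this
      have h2 := mass_C_le (ι := ι) (d / 2)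
      rw [abs_of_nonneg (by positivity)] at h2
      linarith
    | succ l =>
      rw [hA's, hmBs]
      have h1 := hAmass (l + 1)
      have h2 := hAmass l
      rw [← hd] at h1 h2
      push_cast at h1 h2 ⊢
      have h3 : (2 : ℝ) ^ l * 9 ^ (2 ^ l) ≤ 2 ^ (l + 1) * 9 ^ (2 ^ (l + 1)) :=
        mul_le_mul (pow_le_pow_right₀ one_le_two (Nat.le_succ l)) (pow_le_pow_right₀ (by norm_num)
          (Nat.pow_le_pow_right two_pos (Nat.le_succ l))) (by positivity) (by positivity)
      have h4 := mul_le_mul_of_nonneg_left h3 hd0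
      linarith
  -- cube bounds of the increments (module 139 §2)
  have hBR : ∀ l, l < J + 1 → ∀ x : ι → ℝ, (∀ i, x i ∈ Set.Icc (-1 : ℝ) 1) → |MvPolynomial.eval x (B l)| ≤ R l := by
    intro l _ x hx
    rw [hB, map_sub]
    cases l with
    | zero =>
      rw [hA'0, hR0', MvPolynomial.eval_C]
      have h1 := hAerr 0 x hx
      have h2 := abs_l1Norm_sub_half_le x hx
      rw [pow_zero, Nat.cast_one, div_one, ← hd] at h1
      rw [← hd] at h2
      calc |MvPolynomial.eval x (A 0) - d / 2|
          ≤ |MvPolynomial.eval x (A 0) - (∑ i, |x i|)| + |(∑ i, |x i|) - d / 2| := abs_sub_le _ _ _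
        _ ≤ d * π + d / 2 := by rw [abs_sub_comm] at h1; exact add_le_add h1 h2
        _ = d * (1 / 2 + π) := by ring
    | succ l =>
      rw [hA's, hRs]
      have h1 := hAerr (l + 1) x hx
      have h2 := hAerr l x hx
      rw [← hd] at h1 h2
      calc |MvPolynomial.eval x (A (l + 1)) - MvPolynomial.eval x (A l)|
          ≤ |MvPolynomial.eval x (A (l + 1)) - (∑ i, |x i|)| + |(∑ i, |x i|) - MvPolynomial.eval x (A l)| := abs_sub_le _ _ _
        _ ≤ d * (π / (2 ^ (l + 1) : ℕ)) + d * (π / (2 ^ l : ℕ)) := by rw [abs_sub_comm] at h1; exact add_le_add h1 h2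
        _ = 3 * d * π / 2 ^ (l + 1) := by push_cast; rw [pow_succ]; field_simp; ring
  have hnl : ∀ l, l < J + 1 → 1 ≤ n l ∧ Real.exp 2 * (ω * R l) ≤ n l := by
    intro l _
    rw [hn]
    refine ⟨hh.trans (Nat.le_add_left h _), ?_⟩
    push_cast
    exact (Nat.le_ceil _).trans (le_add_of_nonneg_right (Nat.cast_nonneg _))
  have hηl : ∀ l, Real.exp (ω * R l - n l) ≤ Real.exp (-(h : ℝ)) := by
    intro l
    refine Real.exp_le_exp.2 ?_
    rw [hn]; push_cast
    have h1 : ω * R l ≤ Real.exp 2 * (ω * R l) := by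
      have : (1 : ℝ) ≤ Real.exp 2 := Real.one_le_exp (by norm_num)
      nlinarith [mul_nonneg hω (hR0 l)]
    have h2 := Nat.le_ceil (Real.exp 2 * (ω * R l))
    linarith
  have hηsum : ∑ l ∈ range (J + 1), Real.exp (ω * R l - n l) ≤ ((J : ℝ) + 1) * Real.exp (-(h : ℝ)) := by
    calc ∑ l ∈ range (J + 1), Real.exp (ω * R l - n l) ≤ ∑ _l ∈ range (J + 1), Real.exp (-(h : ℝ)) :=
          Finset.sum_le_sum fun l _ => hηl l
      _ = ((J : ℝ) + 1) * Real.exp (-(h : ℝ)) := by rw [sum_const, card_range, nsmul_eq_mul]; push_cast; ring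
  -- the Taylor ladder with mass
  obtain ⟨Cr, Ci, hCr, hCi, happ⟩ :=
    exists_pair_near_cexp_sum_taylor_mass (ι := ι) (ω * (d / 2)) hω B mB R n (J + 1) hmassB hBR hnl (hηsum.trans hJh)
  -- the mass of the ladder: `∏_{l≤J} 2(1 + ω m_B(l))^{n_l − 1} ≤ exp Λ`
  set Λ : ℝ := ((J : ℝ) + 1) * Real.log 2 + (6 * π * Real.exp 2 * a + h * ((J : ℝ) + 1)) * Real.log (1 + 10 * a) +
    (3 * π * Real.exp 2 * a * ((J : ℝ) + 1) + h * (2 ^ (J + 1) - 1)) * Real.log 81 with hΛ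
  have hν : ∀ l, ((n l - 1 : ℕ) : ℝ) ≤ 3 * π * Real.exp 2 * a / 2 ^ l + h := by
    intro l
    have hn1 : 1 ≤ n l := by rw [hn]; exact hh.trans (Nat.le_add_left h _)
    rw [Nat.cast_sub hn1, hn]; push_cast
    have hceil : (⌈Real.exp 2 * (ω * R l)⌉₊ : ℝ) < Real.exp 2 * (ω * R l) + 1 :=
      Nat.ceil_lt_add_one (mul_nonneg (Real.exp_pos _).le (mul_nonneg hω (hR0 l)))
    have hωR : ω * R l ≤ 3 * π * a / 2 ^ l := by
      cases l with
      | zero => rw [hR0', pow_zero, div_one, ha]; nlinarith [mul_nonneg hω hd0]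
      | succ l => rw [hRs, ha]; exact le_of_eq (by ring)
    have he0 : 0 ≤ Real.exp 2 := (Real.exp_pos 2).le
    have hT : Real.exp 2 * (ω * R l) ≤ 3 * π * Real.exp 2 * a / 2 ^ l :=
      calc Real.exp 2 * (ω * R l) ≤ Real.exp 2 * (3 * π * a / 2 ^ l) := mul_le_mul_of_nonneg_left hωR he0
        _ = 3 * π * Real.exp 2 * a / 2 ^ l := by ring
    linarith [hceil, hT]
  have hX1 : ∀ l, 1 + ω * mB l ≤ (1 + 10 * a) * 81 ^ (2 ^ l) := by
    intro l
    have h81 : (1 : ℝ) ≤ 81 ^ (2 ^ l) := one_le_pow₀ (by norm_num)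
    cases l with
    | zero => rw [hmB0]; nlinarith [ha0]
    | succ l =>
      rw [hmBs]
      have h29 : (2 : ℝ) ^ (l + 1) * 9 ^ (2 ^ (l + 1)) ≤ 81 ^ (2 ^ (l + 1)) := by
        rw [show (81 : ℝ) = 9 * 9 by norm_num, mul_pow]
        refine mul_le_mul_of_nonneg_right ?_ (by positivity)
        calc (2 : ℝ) ^ (l + 1) ≤ 9 ^ (l + 1) := pow_le_pow_left₀ zero_le_two (by norm_num) _
          _ ≤ 9 ^ (2 ^ (l + 1)) := pow_le_pow_right₀ (by norm_num) (Nat.lt_two_pow_self).le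
      have h1 := mul_le_mul_of_nonneg_left h29 (by positivity : (0 : ℝ) ≤ 2 * a)
      have h81' : (1 : ℝ) ≤ 81 ^ (2 ^ (l + 1)) := one_le_pow₀ (by norm_num)
      have e : ω * (2 * d * (2 ^ (l + 1) * 9 ^ 2 ^ (l + 1))) = 2 * a * (2 ^ (l + 1) * 9 ^ 2 ^ (l + 1)) := by rw [ha]; ring
      rw [e]
      nlinarith [ha0, h81']
  have hfac : ∀ l ∈ range (J + 1), 2 * (1 + ω * mB l) ^ (n l - 1) ≤
      Real.exp (Real.log 2 + (3 * π * Real.exp 2 * a / 2 ^ l + h) * (Real.log (1 + 10 * a) + 2 ^ l * Real.log 81)) := by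
    intro l hl
    have hmB0' : 0 ≤ ω * mB l :=
      mul_nonneg hω ((Finset.sum_nonneg fun s _ => abs_nonneg _).trans (hmassB l (mem_range.1 hl)))
    exact level_mass_le ha0 hmB0' (hX1 l) (hν l)
  have hpos : ∀ l ∈ range (J + 1), 0 ≤ 2 * (1 + ω * mB l) ^ (n l - 1) := by
    intro l hl
    have hmB0' : 0 ≤ ω * mB l :=
      mul_nonneg hω ((Finset.sum_nonneg fun s _ => abs_nonneg _).trans (hmassB l (mem_range.1 hl)))
    positivity
  have hsum_exp : ∑ l ∈ range (J + 1), (Real.log 2 + (3 * π * Real.exp 2 * a / 2 ^ l + h) * (Real.log (1 + 10 * a) + 2 ^ l * Real.log 81)) ≤ Λ := by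
    have hsplit : ∀ l : ℕ, Real.log 2 + (3 * π * Real.exp 2 * a / 2 ^ l + h) * (Real.log (1 + 10 * a) + 2 ^ l * Real.log 81) =
        Real.log 2 + (3 * π * Real.exp 2 * a * Real.log (1 + 10 * a)) * (1 / 2 ^ l) + h * Real.log (1 + 10 * a) +
          3 * π * Real.exp 2 * a * Real.log 81 + (h * Real.log 81) * 2 ^ l := by
      intro l
      have h2 : (2 : ℝ) ^ l ≠ 0 := pow_ne_zero _ two_ne_zero
      field_simp
      ring
    simp only [hsplit, Finset.sum_add_distrib, Finset.sum_const, card_range, nsmul_eq_mul, ← Finset.mul_sum]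
    have hgeo1 : ∑ l ∈ range (J + 1), (1 : ℝ) / 2 ^ l ≤ 2 := by
      have e : ∀ l : ℕ, (1 : ℝ) / 2 ^ l = (1 / 2) ^ l := fun l => by rw [one_div, one_div, inv_pow]
      simp only [e]
      have := geom_sum_eq (x := (1 / 2 : ℝ)) (by norm_num) (J + 1)
      rw [this]
      have hp : (0 : ℝ) < (1 / 2) ^ (J + 1) := by positivity
      have : ((1 / 2 : ℝ) ^ (J + 1) - 1) / (1 / 2 - 1) = 2 * (1 - (1 / 2) ^ (J + 1)) := by field_simp; ring
      rw [this]; nlinarith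
    have hgeo2 : ∑ l ∈ range (J + 1), (2 : ℝ) ^ l = 2 ^ (J + 1) - 1 := by
      have := geom_sum_eq (x := (2 : ℝ)) (by norm_num) (J + 1)
      rw [this]; ring
    rw [hgeo2]
    have hc0 : 0 ≤ 3 * π * Real.exp 2 * a * Real.log (1 + 10 * a) :=
      mul_nonneg (by positivity) (Real.log_nonneg (by linarith))
    have := mul_le_mul_of_nonneg_left hgeo1 hc0
    rw [hΛ]; push_cast
    nlinarith [this]
  have hmass_tot : ∏ l ∈ range (J + 1), 2 * (1 + ω * mB l) ^ (n l - 1) ≤ Real.exp Λ := by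
    calc ∏ l ∈ range (J + 1), 2 * (1 + ω * mB l) ^ (n l - 1)
        ≤ ∏ l ∈ range (J + 1), Real.exp (Real.log 2 + (3 * π * Real.exp 2 * a / 2 ^ l + h) *
            (Real.log (1 + 10 * a) + 2 ^ l * Real.log 81)) := Finset.prod_le_prod hpos hfac
      _ = Real.exp (∑ l ∈ range (J + 1), (Real.log 2 + (3 * π * Real.exp 2 * a / 2 ^ l + h) *
            (Real.log (1 + 10 * a) + 2 ^ l * Real.log 81))) := (Real.exp_sum _ _).symm
      _ ≤ Real.exp Λ := Real.exp_le_exp.2 hsum_exp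
  refine ⟨Cr, Ci, A J, hCr.trans hmass_tot, hCi.trans hmass_tot, ?_, fun x hx => ?_, fun x hx => ?_⟩
  · have := hAmass J; rw [← hd] at this; push_cast at this; exact this
  · have := hAerr J x hx
    rw [← hd] at this; push_cast at this
    calc |(∑ i, |x i|) - MvPolynomial.eval x (A J)| ≤ d * (π / 2 ^ J) := this
      _ = d * π / 2 ^ J := by ring
  -- the phase telescopes to `ω·A_J(x)`
  have htel : ω * (d / 2) + ω * ∑ l ∈ range (J + 1), MvPolynomial.eval x (B l) = ω * MvPolynomial.eval x (A J) := by
    have hsumB : ∑ l ∈ range (J + 1), MvPolynomial.eval x (B l) = MvPolynomial.eval x (A J) - d / 2 := by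
      have hsub : ∀ l, MvPolynomial.eval x (B l) = MvPolynomial.eval x (A l) - MvPolynomial.eval x (A' l) := fun l => by
        rw [hB, map_sub]
      simp only [hsub, Finset.sum_sub_distrib]
      rw [Finset.sum_range_succ (fun l => MvPolynomial.eval x (A l)), Finset.sum_range_succ' (fun l => MvPolynomial.eval x (A' l))]
      have hxA'0 : MvPolynomial.eval x (A' 0) = d / 2 := by rw [hA'0, MvPolynomial.eval_C]
      have hxA's : ∀ l, MvPolynomial.eval x (A' (l + 1)) = MvPolynomial.eval x (A l) := fun l => by rw [hA's]
      simp only [hxA'0, hxA's]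
      ring
    rw [hsumB]; ring
  have happ' := happ x hx
  rw [htel] at happ'
  exact happ'.trans (by nlinarith [hηsum, Real.exp_pos (-(h : ℝ))])

/-! ## §2 ★★ The first-order correction with mass — parametric form [folklore] -/

/-- ★★ **THE SINGLE MODE WITH THE FIRST-ORDER TAIL CORRECTION, WITH MASS (parametric).**  For `ω ≥ 0`, `J : ℕ`, `h ≥ 1`, `N ≥ 2^J` with
`(J+1)e^{−h} ≤ ½` and `ωdπ ≤ 2^J` (`d = |ι|`) there is a pair of real `MvPolynomial`s `(Cr, Ci)` with masses `≤ exp Λ·(1 + 2ωd·N·9^N)` (`Λ` as in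
§1) and, on `[−1,1]^ι`, `‖Cr(x) + Ci(x)·i − e^{iωΣ_i|x_i|}‖ ≤ 2(J+1)e^{−h}(1 + ωdπ∕2^J + ωdπ∕N) + (ωdπ∕2^J)² + ωdπ∕N`
(§1 times `(1 + iω(A_N − A_J))`, PART A §4; `mass(A_N − A_J) ≤ dN9^N + d2^J9^{2^J} ≤ 2dN9^N`). [folklore] -/
theorem exists_pair_near_cexp_l1Norm_firstOrder_mass {ω : ℝ} (hω : 0 ≤ ω) (J h N : ℕ) (hh : 1 ≤ h)
    (hJh : ((J : ℝ) + 1) * Real.exp (-(h : ℝ)) ≤ 1 / 2) (hN : 2 ^ J ≤ N) (hρ : ω * Fintype.card ι * π ≤ 2 ^ J) :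
    ∃ Cr Ci : MvPolynomial ι ℝ,
      (∑ s ∈ Cr.support, |Cr.coeff s|) ≤ Real.exp (((J : ℝ) + 1) * Real.log 2 +
          (6 * π * Real.exp 2 * (ω * Fintype.card ι) + h * ((J : ℝ) + 1)) * Real.log (1 + 10 * (ω * Fintype.card ι)) +
          (3 * π * Real.exp 2 * (ω * Fintype.card ι) * ((J : ℝ) + 1) + h * (2 ^ (J + 1) - 1)) * Real.log 81) *
        (1 + 2 * (ω * Fintype.card ι) * (N * 9 ^ N)) ∧
      (∑ s ∈ Ci.support, |Ci.coeff s|) ≤ Real.exp (((J : ℝ) + 1) * Real.log 2 +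
          (6 * π * Real.exp 2 * (ω * Fintype.card ι) + h * ((J : ℝ) + 1)) * Real.log (1 + 10 * (ω * Fintype.card ι)) +
          (3 * π * Real.exp 2 * (ω * Fintype.card ι) * ((J : ℝ) + 1) + h * (2 ^ (J + 1) - 1)) * Real.log 81) *
        (1 + 2 * (ω * Fintype.card ι) * (N * 9 ^ N)) ∧
      ∀ x : ι → ℝ, (∀ i, x i ∈ Set.Icc (-1 : ℝ) 1) →
        ‖((MvPolynomial.eval x Cr : ℝ) : ℂ) + ((MvPolynomial.eval x Ci : ℝ) : ℂ) * I - exp (((ω * ∑ i, |x i| : ℝ) : ℂ) * I)‖ ≤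
          2 * ((J : ℝ) + 1) * Real.exp (-(h : ℝ)) *
              (1 + ω * Fintype.card ι * π / 2 ^ J + ω * Fintype.card ι * π / N) +
            (ω * Fintype.card ι * π / 2 ^ J) ^ 2 + ω * Fintype.card ι * π / N := by
  set d : ℝ := (Fintype.card ι : ℝ) with hd
  have hd0 : 0 ≤ d := Nat.cast_nonneg _
  have hNpos : 0 < N := lt_of_lt_of_le (pow_pos two_pos J) hN
  have hNr : (0 : ℝ) < N := by exact_mod_cast hNpos
  have h2J : (0 : ℝ) < 2 ^ J := by positivity
  obtain ⟨Cr₀, Ci₀, A, hCr₀, hCi₀, hAmass, hAerr, happ₀⟩ :=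
    exists_ladder_pair_near_cexp_additiveJackson_mass (ι := ι) hω J h hh hJh
  obtain ⟨AN, hANmass, hANerr⟩ := exists_additiveJackson_mass (ι := ι) (M := N) hNpos
  have hε0 : 0 ≤ 2 * ((J : ℝ) + 1) * Real.exp (-(h : ℝ)) := by positivity
  have hρ1 : ω * d * π / 2 ^ J ≤ 1 := by rw [div_le_one h2J]; exact hρ
  -- mass of `Δ = A_N − A_J`
  have hΔmass : (∑ s ∈ (AN - A).support, |(AN - A).coeff s|) ≤ 2 * d * (N * 9 ^ N) := by
    refine (mass_sub_le _ _).trans ?_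
    rw [← hd] at hANmass hAmass
    have hmono : (2 : ℝ) ^ J * 9 ^ (2 ^ J) ≤ N * 9 ^ N := by
      have h1 : ((2 ^ J : ℕ) : ℝ) ≤ N := by exact_mod_cast hN
      push_cast at h1
      exact mul_le_mul h1 (pow_le_pow_right₀ (by norm_num) hN) (by positivity) hNr.le
    have := mul_le_mul_of_nonneg_left hmono hd0
    linarith
  have hE : ∀ x : ι → ℝ, (∀ i, x i ∈ Set.Icc (-1 : ℝ) 1) →
      |ω * ((∑ i, |x i|) - MvPolynomial.eval x A)| ≤ ω * d * π / 2 ^ J := by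
    intro x hx
    rw [abs_mul, abs_of_nonneg hω, mul_assoc, mul_div_assoc]
    exact mul_le_mul_of_nonneg_left (hAerr x hx) hω
  have hEΔ : ∀ x : ι → ℝ, (∀ i, x i ∈ Set.Icc (-1 : ℝ) 1) →
      |ω * (((∑ i, |x i|) - MvPolynomial.eval x A) - MvPolynomial.eval x (AN - A))| ≤ ω * d * π / N := by
    intro x hx
    have e : ((∑ i, |x i|) - MvPolynomial.eval x A) - MvPolynomial.eval x (AN - A) = (∑ i, |x i|) - MvPolynomial.eval x AN := by
      rw [map_sub]; ring
    rw [e, abs_mul, abs_of_nonneg hω, mul_assoc, mul_div_assoc]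
    refine mul_le_mul_of_nonneg_left ?_ hω
    calc |(∑ i, |x i|) - MvPolynomial.eval x AN| ≤ Fintype.card ι * (π / N) := hANerr x hx
      _ = d * π / N := by rw [hd]; ring
  obtain ⟨Cr, Ci, hCr, hCi, happ⟩ := exists_pair_firstOrder_step_mass (θ := fun x => ω * MvPolynomial.eval x A)
    (E := fun x => (∑ i, |x i|) - MvPolynomial.eval x A) hCr₀ hCi₀ hΔmass hε0 hρ1 hω happ₀ hE hEΔ
  have emass : 1 + ω * (2 * d * (N * 9 ^ N)) = 1 + 2 * (ω * d) * (N * 9 ^ N) := by ring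
  rw [emass] at hCr hCi
  refine ⟨Cr, Ci, hCr, hCi, fun x hx => ?_⟩
  have harg : ω * MvPolynomial.eval x A + ω * ((∑ i, |x i|) - MvPolynomial.eval x A) = ω * ∑ i, |x i| := by ring
  have := happ x hx
  simp only [harg] at this
  exact this

end Summit.QuantumFields.YangMills.Theorems.BalabanUVNodesN19SingleModeMomentFirstOrderLadder

end
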